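import Literature.Barriers.CriticalPhenomena.LongRangeTrivialityOnZ3WickReduction
import Literature.Barriers.CriticalPhenomena.LongRangeTrivialityOnZ3TreeBound
import Literature.Barriers.CriticalPhenomena.LongRangeTrivialityOnZ3NoSlidingScale
import Literature.Barriers.CriticalPhenomena.LongRangeTrivialityOnZ3TwoPointProofs
import Literature.Probability.LatticeModels.TreeGraphWickPairInteraction
import Literature.Probability.LatticeModels.AizenmanWickBoundLocal

/-!
# `LongRangeTrivialityOnZ3` from the infrared bound alone, via the tree-graph Wick bound

Barrier catalogue (D-0021), sibling of `LongRangeTrivialityOnZ3.lean` (sub-problem `Ising3DConformalLimit`).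
The previous reductions of this barrier (`…TreeBound`: `LongRangeTrivialityOnZ3.of_unitFacts`) rested on
three named facts: Aizenman's deviation-from-Wick bound for unit couplings on finite graphs
(`aizenman_wickDeviation_le_finite`, Aizenman 1982 Prop. 12.1 — whose printed proof is not among the held
sources), the tree diagram bound (since proved: `treeDiagramBound_holds`, `panis_treeDiagramBound_holds`)
and the infrared bound `panis_infraredBound_algebraic`. This file removes the first: the chain only ever
uses Prop. 12.1 followed by the tree diagram bound, and that COMBINATION — with the tree diagram `T` in
place of `|U₄|` and constant `2` in place of `(3/2)·2` — is the theorem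
`PairIsing.abs_avg_spinMonomial_sub_pairingSum_le` of `Literature/Probability/LatticeModels/TreeGraphWick*.lean`
(random currents: switching lemma, many-source tree bound, greedy pairing; pendant spins for coincident
points). Consequently

  `LongRangeTrivialityOnZ3.of_irb : panis_infraredBound_algebraic → LongRangeTrivialityOnZ3`

— the barrier now rests on the infrared bound alone (Panis 2023, Prop. 3.8 / §3.6; reduced in
`…InfraredBound(Fourier)` to Proposition 3.7 and the ABF summability below `β_c`).

Contents: the tree-graph Wick bound for `⟨·⟩_{Λ,J,0,β}` (`abs_corrIn_sub_pairingSum_le`, any `J ≥ 0` on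
`ℤ^d`) and for the infinite-volume state at quadruples with finite tree diagrams
(`abs_corr_sub_pairingSum_le`, box limit), its window-state form, the even-moment and
moment-generating-function bounds with the tree box sum `𝒮_T(β,L,R) = Σ_L⁻² ∑_{u∈Λ_{RL}⁴} T(u)`
(`evenMoment_deviation_le_tree`, `mgfDeviation_le_tree`, through the generic smearing theorem
`abs_integral_normalizedField_pow_sub_le_of_remainderBoundOn` and `abs_mgf_sub_exp_le_of_wickMoment_bounds`),
the identity `∑_{u∈Λ⁴} T(u) = ∑_v F(v)⁴` giving finiteness and the `d = 3` bound
`𝒮_T ≤ C(β⁻⁴∨β⁻²)R^{15}/L^{3-2α}` along the computation of `…NoSlidingScale`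
(`treeFourBoxSum_le_dim3_mms`), `panis_thm12_dim3_of_tree` and the headline.

## References

* R. Panis, arXiv:2309.05797 (2023) = Ann. Probab. 54 (2026): Theorem 1.2, Prop. 4.6, §4.2, proof of
  Theorem 5.5 (pp. 21–22) [Panis2023Triviality] (held; read pp. 19–22).
* M. Aizenman, Comm. Math. Phys. 86 (1982), Prop. 5.3, Prop. 12.1 [AizenmanCMP1982];
  M. Aizenman, CDM 2020, arXiv:2112.04248, Prop. 7.2, (7.6)–(7.10), Lemma 8.1 [AizenmanCDM2020] (read).

## Tree anchors

`corrIn`, `pairIn`, `pairIn_eq`, `windowState`, `nPoint_windowState`, `twoPoint_windowState`,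
`integral_normalizedField_windowState`, `blockSpinVariance_windowState`, `latticeBox_natCast_mul`,
`tendsto_corrIn_box`, `tendsto_pairIn_box`, `pairingSum_congr_apply` (`…Wick`); `corrIn_coe_eq_avg`,
`pairIn_coe_eq_avg` (`…WickReduction`); `pairIn_nonneg_and_le_pairCorrelation` (`…TreeBound`);
`windowMeasure`, `state_fun_smeared_eq_integral`, `state_smeared_odd_pow`, `mem_box_mul_of_apply_ne_zero`
(`…Moments`); `boxRowSum`, `rowMajorant`, `summable_rowMajorant`, `sum_piFinset_prod_eq`,
`boxSusceptibility_le_of_irb`, `panis_thm12_dim3`, `LongRangeTrivialityOnZ3.of_thm12_dim3` (`…UrsellSum`);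
`boxRowSum_le_near_mms`, `boxRowSum_pow_four_le_far_mms`, `near_term_le_mms`, `far_term_le_mms`
(`…NoSlidingScale`); `panis_mms_two_point_monotone_holds` (`…MMSWalk`),
`panis_boxSusceptibility_le_blockVariance_holds` (`…TwoPointProofs`); `abs_mgf_sub_exp_le_of_wickMoment_bounds`,
`tendsto_wickRemainder`, `wickRemainder_congr_of_eq` (`AizenmanWickBound`); `pairingSum_congr_of_eq`,
`tendsto_pairingSum` (`GaussianPairingBound`, `HighDimTrivialityWick`).
-/

noncomputable section

namespace Literature.Barriers.CriticalPhenomena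

open Literature.Probability.LatticeModels Literature.Probability.Percolation MeasureTheory Filter Finset
open _root_.Topology
open scoped symmDiff ENNReal Nat

namespace LongRangeIsing

variable {d : ℕ} (J : Site d → Site d → ℝ) (Λ : Finset (Site d)) (β : ℝ)

/-! ### The tree diagram in finite and infinite volume -/

/-- The finite-volume tree diagram `T_Λ(u) = ∑_{v∈Λ} ∏_j ⟨σ_{u_j}σ_v⟩_{Λ,J,0,β}` of a quadruple of sites.
[cite: AizenmanCDM2020, Lemma 8.1, eq. (8.2)] -/
def treeFourIn (u : Fin 4 → Site d) : ℝ := ∑ v ∈ Λ, ∏ j, pairIn J Λ β (u j) v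

/-- The infinite-volume tree diagram `T(u) = ∑_{v∈ℤ^d} ∏_j ⟨σ_{u_j}σ_v⟩_β` in `ℝ≥0∞` (a possibly divergent
series of nonnegative terms). [cite: Panis2023Triviality, §4.2 (tree diagram bound, display after Proposition 4.7)] -/
def treeFourE (u : Fin 4 → Site d) : ℝ≥0∞ := ∑' v, ∏ j, ENNReal.ofReal (pairCorrelation J β (u j) v)

/-- **The tree-graph Wick bound in finite volume** (general ferromagnetic pair interaction `J ≥ 0` on `ℤ^d`,
free boundary condition, zero field, `β ≥ 0`, points of `Λ`, coincidences allowed):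
`|⟨σ_{x₁}⋯σ_{x_{2n}}⟩_Λ - 𝒢_n[⟨σσ⟩_Λ](x)| ≤ 2 ∑_{|s|=4} T_Λ(x_s) 𝒢_{n-2}[⟨σσ⟩_Λ](x^{(s̸)})` — the state
`⟨·⟩_{Λ,J,0,β}` is the pair-interaction average `PairIsing.avg ((β/2)J|_Λ)`, to which
`PairIsing.abs_avg_spinMonomial_sub_pairingSum_le` applies. [cite: AizenmanCMP1982, Prop. 12.1 and Prop. 5.3] [cite: Panis2023Triviality, Prop. 4.6 and §4.2] -/
theorem abs_corrIn_sub_pairingSum_le (hJ : ∀ x y, 0 ≤ J x y) (hβ : 0 ≤ β) (n : ℕ) (x : Fin (2 * n) → Site d)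
    (hx : ∀ i, x i ∈ Λ) :
    |corrIn J Λ β x - pairingSum (pairIn J Λ β) n x| ≤ 2 * wickRemainder (pairIn J Λ β) (treeFourIn J Λ β) n x := by
  set c : ↥Λ → ↥Λ → ℝ := fun a b => β / 2 * J a b with hc
  have hc0 : ∀ a b : ↥Λ, 0 ≤ c a b := fun a b => mul_nonneg (div_nonneg hβ zero_le_two) (hJ _ _)
  set x' : Fin (2 * n) → ↥Λ := fun i => ⟨x i, hx i⟩ with hx'
  have hN : corrIn J Λ β x = PairIsing.avg c (spinMonomial x') := corrIn_coe_eq_avg J Λ β x'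
  have h2 : ∀ i j, pairIn J Λ β (x i) (x j) = PairIsing.avg c (spinPair (x' i) (x' j)) :=
    fun i j => pairIn_coe_eq_avg J Λ β (x' i) (x' j)
  have hU : ∀ e : Fin 4 → Fin (2 * n), treeFourIn J Λ β (x ∘ e) =
      ∑ v : ↥Λ, ∏ j, PairIsing.avg c (spinPair ((x' ∘ e) j) v) := by
    intro e
    rw [treeFourIn, ← Finset.sum_coe_sort Λ]
    refine Finset.sum_congr rfl fun v _ => Finset.prod_congr rfl fun j _ => ?_
    exact pairIn_coe_eq_avg J Λ β (x' (e j)) v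
  rw [hN, pairingSum_congr_of_eq (pairIn J Λ β) (fun a b => PairIsing.avg c (spinPair a b)) n x x' h2,
    wickRemainder_congr_of_eq (pairIn J Λ β) (fun a b => PairIsing.avg c (spinPair a b)) (treeFourIn J Λ β)
      (fun u => ∑ v : ↥Λ, ∏ j, PairIsing.avg c (spinPair (u j) v)) n x x' h2 hU]
  exact PairIsing.abs_avg_spinMonomial_sub_pairingSum_le c hc0 n x'

omit Λ in
/-- Monotonicity of the remainder in the four-point weight (for a nonnegative two-point function). [folklore] -/
theorem wickRemainder_mono_right {α : Type*} {S : α → α → ℝ} (hS : ∀ a b, 0 ≤ S a b)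
    {U U' : (Fin 4 → α) → ℝ} {n : ℕ} {x : Fin (2 * n) → α}
    (h : ∀ s : {s : Finset (Fin (2 * n)) // s.card = 4}, |U (restrictFour x s)| ≤ |U' (restrictFour x s)|) :
    wickRemainder S U n x ≤ wickRemainder S U' n x :=
  Finset.sum_le_sum fun s _ => mul_le_mul_of_nonneg_right (h s) (PairIsing.pairingSum_nonneg' hS _ _)

/-- The finite-volume tree diagram is dominated by the infinite-volume one (Griffiths II for each factor,
and a partial sum of a nonnegative series), when the latter is finite. [folklore] -/
theorem treeFourIn_le_toReal_treeFourE (hJ : ∀ x y, 0 ≤ J x y) (hβ : 0 ≤ β) {u : Fin 4 → Site d}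
    (hu : ∀ j, u j ∈ Λ) (hfin : treeFourE J β u ≠ ⊤) :
    treeFourIn J Λ β u ≤ (treeFourE J β u).toReal := by
  have hS0 : ∀ a b, 0 ≤ pairCorrelation J β a b := fun a b => pairCorrelation_nonneg J β hβ hJ a b
  have h1 : treeFourIn J Λ β u ≤ ∑ v ∈ Λ, ∏ j, pairCorrelation J β (u j) v :=
    Finset.sum_le_sum fun v hv => Finset.prod_le_prod
      (fun j _ => (pairIn_nonneg_and_le_pairCorrelation J β hβ hJ (hu j) hv).1)
      fun j _ => (pairIn_nonneg_and_le_pairCorrelation J β hβ hJ (hu j) hv).2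
  have h2 : ∑ v ∈ Λ, ∏ j, pairCorrelation J β (u j) v =
      (∑ v ∈ Λ, ∏ j, ENNReal.ofReal (pairCorrelation J β (u j) v)).toReal := by
    rw [ENNReal.toReal_sum fun v _ => ENNReal.prod_ne_top fun j _ => ENNReal.ofReal_ne_top]
    refine Finset.sum_congr rfl fun v _ => ?_
    rw [ENNReal.toReal_prod]
    exact Finset.prod_congr rfl fun j _ => (ENNReal.toReal_ofReal (hS0 _ _)).symm
  rw [h2] at h1
  exact h1.trans (ENNReal.toReal_mono hfin (ENNReal.sum_le_tsum _))

omit Λ in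
/-- **The tree-graph Wick bound for the infinite-volume state** `⟨·⟩_{J,0,β}` (`J ≥ 0`, `β ≥ 0`), at
quadruples with finite tree diagrams:
`|⟨σ_{x₁}⋯σ_{x_{2n}}⟩ - 𝒢_n[⟨σσ⟩](x)| ≤ 2 ∑_{|s|=4} T(x_s) 𝒢_{n-2}[⟨σσ⟩](x^{(s̸)})` (finite volume, then
the box limit). [cite: AizenmanCMP1982, Prop. 12.1 and Prop. 5.3] [cite: Panis2023Triviality, Prop. 4.6 and §4.2] -/
theorem abs_corr_sub_pairingSum_le (hβ : 0 ≤ β) (hJ : ∀ x y, 0 ≤ J x y) (n : ℕ) (x : Fin (2 * n) → Site d)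
    (hfin : ∀ s : {s : Finset (Fin (2 * n)) // s.card = 4}, treeFourE J β (restrictFour x s) ≠ ⊤) :
    |corr J β x - pairingSum (pairCorrelation J β) n x| ≤
      2 * wickRemainder (pairCorrelation J β) (fun u => (treeFourE J β u).toReal) n x := by
  have hT := fun a b => tendsto_pairIn_box J β hβ hJ a b
  refine le_of_tendsto_of_tendsto
    (((tendsto_corrIn_box J β hβ hJ x).sub (tendsto_pairingSum hT n x)).abs)
    (Tendsto.const_mul _ (tendsto_wickRemainder hT (U := fun _ u => (treeFourE J β u).toReal)
      (fun u => tendsto_const_nhds) n x)) ?_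
  filter_upwards [eventually_forall_mem_box x] with L hL
  refine (abs_corrIn_sub_pairingSum_le J (box d L) β hJ hβ n x hL).trans (mul_le_mul_of_nonneg_left ?_ (by norm_num))
  refine wickRemainder_mono_right (fun a b => ?_) fun s => ?_
  · rw [pairIn_eq]; exact expectIn_spinProduct_nonneg J (box d L) β hβ hJ _
  · have h0 : 0 ≤ treeFourIn J (box d L) β (restrictFour x s) :=
      Finset.sum_nonneg fun v _ => Finset.prod_nonneg fun j _ => by
        rw [pairIn_eq]; exact expectIn_spinProduct_nonneg J (box d L) β hβ hJ _
    rw [abs_of_nonneg h0, abs_of_nonneg ENNReal.toReal_nonneg]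
    exact treeFourIn_le_toReal_treeFourE J (box d L) β hJ hβ (fun j => hL _) (hfin s)

/-- **The window state satisfies the tree-graph Wick bound at all points of `Λ_{RL} ⊆ B`** with finite
tree diagrams. [cite: AizenmanCMP1982, Prop. 12.1 and Prop. 5.3] -/
theorem treeWickBoundOn_windowState (hβ : 0 ≤ β) (hJ : ∀ x y, 0 ≤ J x y) {B : Finset (Site d)} {L R : ℕ}
    (hRL : box d (R * L) ⊆ B) (n : ℕ) (x : Fin (2 * n) → Site d)
    (hx : ∀ i, x i ∈ latticeBox d ((R : ℝ) * (L : ℝ)))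
    (hfin : ∀ s : {s : Finset (Fin (2 * n)) // s.card = 4}, treeFourE J β (restrictFour x s) ≠ ⊤) :
    |nPoint (windowState J β B hβ hJ) spinAt x - pairingSum (twoPoint (windowState J β B hβ hJ) spinAt) n x| ≤
      2 * wickRemainder (twoPoint (windowState J β B hβ hJ) spinAt) (fun u => (treeFourE J β u).toReal) n x := by
  rw [latticeBox_natCast_mul] at hx
  have hxB : ∀ i, x i ∈ B := fun i => hRL (hx i)
  rw [nPoint_windowState J β B hβ hJ hxB,
    pairingSum_congr_apply (fun i j => twoPoint_windowState J β B hβ hJ (hxB i) (hxB j)),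
    wickRemainder_congr_of_eq (twoPoint (windowState J β B hβ hJ) spinAt) (pairCorrelation J β)
      (fun u => (treeFourE J β u).toReal) (fun u => (treeFourE J β u).toReal)
      n x x (fun i j => twoPoint_windowState J β B hβ hJ (hxB i) (hxB j)) (fun e => rfl)]
  exact abs_corr_sub_pairingSum_le J β hβ hJ n x hfin

end LongRangeIsing

namespace LongRangeIsing

variable {d : ℕ} (J : Site d → Site d → ℝ) (β : ℝ)

/-! ### The tree box sum and the moment bounds -/

/-- The tree box sum `𝒮_T(β,L,R) := Σ_L(β)⁻² ∑_{u ∈ Λ_{RL}⁴} T(u)` (the analogue of Panis's `S(β,L,f)` with the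
tree diagram in place of `|U₄|`; finite tree diagrams are meant, `toReal`). [cite: Panis2023Triviality, proof of Theorem 5.5, definition of S(β,L,f) (p. 21) with the tree diagram bound (p. 22)] -/
def treeFourBoxSum (L R : ℕ) : ℝ :=
  (∑ u ∈ Fintype.piFinset fun _ : Fin 4 => box d (R * L), (treeFourE J β u).toReal) / blockVariance J β L ^ 2

/-- `𝒮_T ≥ 0`. [folklore] -/
theorem treeFourBoxSum_nonneg (L R : ℕ) : 0 ≤ treeFourBoxSum J β L R :=
  div_nonneg (Finset.sum_nonneg fun _ _ => ENNReal.toReal_nonneg) (sq_nonneg _)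

/-- **The even-moment deviation of the smeared field is controlled by the tree box sum** (general
ferromagnetic pair interaction `J ≥ 0` on `ℤ^d`, `β > 0`, natural `L, R ≥ 1`, `f` continuous vanishing off
`[-R,R]^d`, `n ≥ 2`, finite tree diagrams on `Λ_{RL}`):
`|⟨T_{f,L}^{2n}⟩ - (2n)!/(2ⁿn!)⟨T_{f,L}²⟩ⁿ| ≤ 2(2n)⁴ ((2n-4)!/(2^{n-2}(n-2)!)) ⟨T_{|f|,L}²⟩^{n-2} ‖f‖_∞⁴ 𝒮_T(β,L,R)` —
the window state (`LongRangeTrivialityOnZ3Wick`), the tree-graph Wick bound at its points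
(`treeWickBoundOn_windowState`) and the generic smearing theorem
`abs_integral_normalizedField_pow_sub_le_of_remainderBoundOn`. [cite: Panis2023Triviality, proof of Theorem 5.5, first display (p. 21)] [cite: AizenmanCDM2020, Prop. 7.2 and (7.6)–(7.10)] -/
theorem evenMoment_deviation_le_tree (hJ : ∀ x y, 0 ≤ J x y) (hβ : 0 < β) {L R : ℕ} (hL : 1 ≤ L) (hR : 1 ≤ R)
    {f : EuclideanSpace ℝ (Fin d) → ℝ} (hf : Continuous f) (hfR : ∀ x, f x ≠ 0 → ∀ i, |x i| ≤ R)
    (hfin : ∀ u ∈ Fintype.piFinset (fun _ : Fin 4 => box d (R * L)), treeFourE J β u ≠ ⊤) {n : ℕ} (hn : 2 ≤ n) :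
    |state J β 0 (fun σ => smeared J β L f σ ^ (2 * n)) -
        ((2 * n)! : ℝ) / (2 ^ n * n !) * state J β 0 (fun σ => smeared J β L f σ ^ 2) ^ n| ≤
      2 * (2 * n : ℝ) ^ 4 *
        (((2 * (n - 2))! : ℝ) / (2 ^ (n - 2) * (n - 2)!) *
          state J β 0 (fun σ => smeared J β L (fun x => |f x|) σ ^ 2) ^ (n - 2)) *
        (⨆ x, |f x|) ^ 4 * treeFourBoxSum J β L R := by
  have hβ0 : 0 ≤ β := hβ.le
  set B : Finset (Site d) := box d (R * L) with hB
  have hRL : box d (R * L) ⊆ B := Finset.Subset.refl _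
  have hLB : box d L ⊆ B := box_mono d (Nat.le_mul_of_pos_left L hR)
  have hsupp : ∀ x : Site d, f ((L : ℝ)⁻¹ • siteVec x) ≠ 0 → x ∈ B :=
    fun x hx => mem_box_mul_of_apply_ne_zero hfR hL x hx
  have hfaR : ∀ x, (fun x => |f x|) x ≠ 0 → ∀ i, |x i| ≤ R := fun x hx => hfR x (fun h0 => hx (by simp [h0]))
  have hsuppa : ∀ x : Site d, (fun x => |f x|) ((L : ℝ)⁻¹ • siteVec x) ≠ 0 → x ∈ B :=
    fun x hx => mem_box_mul_of_apply_ne_zero hfaR hL x hx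
  have hLpos : (0 : ℝ) < L := by exact_mod_cast hL
  have hfR' : ∀ x, f x ≠ 0 → ∀ i, |x i| ≤ (R : ℝ) := hfR
  -- finiteness of the tree diagrams at the selected points
  have hfin' : ∀ (m : ℕ) (y : Fin (2 * m) → Site d), (∀ i, y i ∈ latticeBox d ((R : ℝ) * (L : ℝ))) →
      ∀ s : {s : Finset (Fin (2 * m)) // s.card = 4}, treeFourE J β (restrictFour y s) ≠ ⊤ := by
    intro m y hy s
    refine hfin _ (Fintype.mem_piFinset.2 fun j => ?_)
    have h := hy (s.1.orderEmbOfFin s.2 j)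
    rw [latticeBox_natCast_mul] at h
    exact h
  have key := abs_integral_normalizedField_pow_sub_le_of_remainderBoundOn
    (μ := windowState J β B hβ0 hJ) (r := (R : ℝ)) hLpos (cW := 2) (by norm_num) (fun u => (treeFourE J β u).toReal)
    (fun m _ y hy => treeWickBoundOn_windowState J β hβ0 hJ hRL m y hy (hfin' m y hy)) hf hfR' hn
  rw [integral_normalizedField_windowState J β B hβ0 hJ hLB f hsupp (fun t => t ^ (2 * n))
      (measurable_id.pow_const _),
    integral_normalizedField_windowState J β B hβ0 hJ hLB f hsupp (fun t => t ^ 2) (measurable_id.pow_const _),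
    integral_normalizedField_windowState J β B hβ0 hJ hLB (fun x => |f x|) hsuppa (fun t => t ^ 2)
      (measurable_id.pow_const _),
    blockSpinVariance_windowState J β B hβ0 hJ hLB, latticeBox_natCast_mul] at key
  have hS : (∑ u ∈ Fintype.piFinset (fun _ : Fin 4 => box d (R * L)), |(treeFourE J β u).toReal|) /
      blockVariance J β L ^ 2 = treeFourBoxSum J β L R := by
    rw [treeFourBoxSum]
    congr 1
    exact Finset.sum_congr rfl fun u _ => abs_of_nonneg ENNReal.toReal_nonneg
  rw [hS] at key
  calc _ ≤ _ := key
    _ = _ := by ring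

/-- **The moment-generating-function deviation is controlled by the tree box sum** ("multiplying by
`z^{2n}/(2n)!` and summing over `n`", `abs_mgf_sub_exp_le_of_wickMoment_bounds` on the window law, flip
symmetry; constant `16·2 = 32`): `J ≥ 0` on `ℤ^d`, `β > 0`, `L, R ≥ 1`, `f` continuous vanishing off
`[-R,R]^d`, finite tree diagrams on `Λ_{RL}`:
`|⟨e^{zT_{f,L}}⟩ - e^{z²⟨T_{f,L}²⟩/2}| ≤ 32 z⁴ e^{z²⟨T_{|f|,L}²⟩/2} ‖f‖_∞⁴ 𝒮_T(β,L,R)`.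
[cite: Panis2023Triviality, proof of Theorem 5.5, first two displays (p. 21)] -/
theorem mgfDeviation_le_tree (hJ : ∀ x y, 0 ≤ J x y) (hβ : 0 < β) {L R : ℕ} (hL : 1 ≤ L) (hR : 1 ≤ R)
    {f : EuclideanSpace ℝ (Fin d) → ℝ} (hf : Continuous f) (hfR : ∀ x, f x ≠ 0 → ∀ i, |x i| ≤ R)
    (hfin : ∀ u ∈ Fintype.piFinset (fun _ : Fin 4 => box d (R * L)), treeFourE J β u ≠ ⊤) (z : ℝ) :
    mgfDeviation J β L f z ≤
      32 * z ^ 4 * Real.exp (z ^ 2 / 2 * state J β 0 (fun σ => smeared J β L (fun x => |f x|) σ ^ 2)) *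
        (⨆ x, |f x|) ^ 4 * treeFourBoxSum J β L R := by
  have hβ0 : 0 ≤ β := hβ.le
  set B : Finset (Site d) := box d (R * L) with hB
  have hsupp : ∀ x : Site d, f ((L : ℝ)⁻¹ • siteVec x) ≠ 0 → x ∈ B :=
    fun x hx => mem_box_mul_of_apply_ne_zero hfR hL x hx
  have hfaR : ∀ x, (fun x => |f x|) x ≠ 0 → ∀ i, |x i| ≤ R := fun x hx => hfR x (fun h0 => hx (by simp [h0]))
  have hsuppa : ∀ x : Site d, (fun x => |f x|) ((L : ℝ)⁻¹ • siteVec x) ≠ 0 → x ∈ B :=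
    fun x hx => mem_box_mul_of_apply_ne_zero hfaR hL x hx
  -- the window law and the two random variables
  set μ := windowMeasure J β B hβ0 hJ with hμ
  set X : SpinConfig ↥B → ℝ := fun τ => smeared J β L f (glue B τ .free) with hX
  set Y : SpinConfig ↥B → ℝ := fun τ => smeared J β L (fun x => |f x|) (glue B τ .free) with hY
  have hSX : ∀ ψ : ℝ → ℝ, state J β 0 (fun σ => ψ (smeared J β L f σ)) = ∫ τ, ψ (X τ) ∂μ :=
    fun ψ => state_fun_smeared_eq_integral J β hβ0 hJ L f hsupp ψ
  have hSY : ∀ ψ : ℝ → ℝ, state J β 0 (fun σ => ψ (smeared J β L (fun x => |f x|) σ)) = ∫ τ, ψ (Y τ) ∂μ :=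
    fun ψ => state_fun_smeared_eq_integral J β hβ0 hJ L (fun x => |f x|) hsuppa ψ
  -- hypotheses of the summation theorem
  have hXm : Measurable X := measurable_of_finite X
  have hXb : ∀ τ, |X τ| ≤ ∑ τ' : SpinConfig ↥B, |X τ'| := fun τ =>
    Finset.single_le_sum (f := fun τ' => |X τ'|) (fun τ' _ => abs_nonneg _) (Finset.mem_univ τ)
  set F4 : ℝ := (⨆ x, |f x|) ^ 4 with hF4
  have hF40 : 0 ≤ F4 := pow_nonneg (Real.iSup_nonneg fun x => abs_nonneg (f x)) 4
  set S : ℝ := treeFourBoxSum J β L R with hS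
  have hS0 : 0 ≤ S := treeFourBoxSum_nonneg J β L R
  set E : ℝ := 2 * F4 * S with hE
  have hE0 : 0 ≤ E := by positivity
  set W : ℝ := ∫ τ, Y τ ^ 2 ∂μ with hW
  have hW0 : 0 ≤ W := integral_nonneg fun τ => sq_nonneg _
  have hdev : ∀ n : ℕ, 2 ≤ n →
      |(∫ τ, X τ ^ (2 * n) ∂μ) - ((2 * n)! : ℝ) / (2 ^ n * n !) * (∫ τ, X τ ^ 2 ∂μ) ^ n|
        ≤ (2 * n : ℝ) ^ 4 * E * ((((2 * (n - 2))! : ℝ) / (2 ^ (n - 2) * (n - 2)!)) * W ^ (n - 2)) := by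
    intro n hn
    have h := evenMoment_deviation_le_tree J β hJ hβ hL hR hf hfR hfin hn
    rw [hSX (fun t => t ^ (2 * n)), hSX (fun t => t ^ 2), hSY (fun t => t ^ 2)] at h
    calc |(∫ τ, X τ ^ (2 * n) ∂μ) - ((2 * n)! : ℝ) / (2 ^ n * n !) * (∫ τ, X τ ^ 2 ∂μ) ^ n|
        ≤ 2 * (2 * n : ℝ) ^ 4 * ((((2 * (n - 2))! : ℝ) / (2 ^ (n - 2) * (n - 2)!)) * W ^ (n - 2)) *
            F4 * S := h
      _ = (2 * n : ℝ) ^ 4 * E * ((((2 * (n - 2))! : ℝ) / (2 ^ (n - 2) * (n - 2)!)) * W ^ (n - 2)) := by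
          rw [hE]; ring
  have hodd : ∀ n : ℕ, ∫ τ, X τ ^ (2 * n + 1) ∂μ = 0 := by
    intro n
    rw [← hSX (fun t => t ^ (2 * n + 1))]
    exact state_smeared_odd_pow J β L f hsupp n
  have key := abs_mgf_sub_exp_le_of_wickMoment_bounds (μ := μ) hXm hXb hE0 hW0 hdev hodd z
  -- back to the state
  have e1 : state J β 0 (fun σ => Real.exp (z * smeared J β L f σ)) = ∫ τ, Real.exp (z * X τ) ∂μ :=
    hSX fun t => Real.exp (z * t)
  have e2 : state J β 0 (fun σ => smeared J β L f σ ^ 2) = ∫ τ, X τ ^ 2 ∂μ := hSX fun t => t ^ 2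
  have e3 : state J β 0 (fun σ => smeared J β L (fun x => |f x|) σ ^ 2) = W := hSY fun t => t ^ 2
  rw [mgfDeviation, e1, e2, e3]
  calc |(∫ τ, Real.exp (z * X τ) ∂μ) - Real.exp (z ^ 2 / 2 * ∫ τ, X τ ^ 2 ∂μ)|
      ≤ 16 * E * z ^ 4 * Real.exp (z ^ 2 / 2 * W) := key
    _ = 32 * z ^ 4 * Real.exp (z ^ 2 / 2 * W) * F4 * S := by rw [hE]; ring

/-! ### The tree box sum on `ℤ³` under the infrared bound -/

/-- **Finiteness and size of the tree diagrams on a box from a summable majorant of `F_N(v)⁴`**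
(`F_N(v) = ∑_{y∈Λ_N}⟨σ_vσ_y⟩`): `∑_{u∈Λ_N⁴} T(u) = ∑_v F_N(v)⁴` (exchange of summations), so if
`F_N⁴ ≤ g` with `g ≥ 0` summable then every `T(u)`, `u ∈ Λ_N⁴`, is finite and
`∑_{u∈Λ_N⁴} T(u) ≤ ∑_v g(v)`. [cite: Panis2023Triviality, proof of Theorem 5.5 ("Applying the tree diagram bound"), p. 22] -/
theorem treeFourE_finite_and_sum_toReal_le {J : Site 3 → Site 3 → ℝ} {β : ℝ} (hβ : 0 ≤ β) (hJ : ∀ x y, 0 ≤ J x y)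
    {N : ℕ} {g : Site 3 → ℝ} (hg0 : ∀ u, 0 ≤ g u) (hgs : Summable g) (hFg : ∀ u, boxRowSum J β N u ^ 4 ≤ g u) :
    (∀ u ∈ Fintype.piFinset (fun _ : Fin 4 => box 3 N), treeFourE J β u ≠ ⊤) ∧
      ∑ u ∈ Fintype.piFinset (fun _ : Fin 4 => box 3 N), (treeFourE J β u).toReal ≤ ∑' v, g v := by
  set P : Finset (Fin 4 → Site 3) := Fintype.piFinset (fun _ : Fin 4 => box 3 N) with hP
  have htot : ∑ u ∈ P, treeFourE J β u ≤ ENNReal.ofReal (∑' v, g v) := by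
    calc ∑ u ∈ P, treeFourE J β u = ∑' v : Site 3, ∑ u ∈ P, ∏ j, ENNReal.ofReal (pairCorrelation J β (u j) v) := by
          simp only [treeFourE]
          exact (Summable.tsum_finsetSum fun _ _ => ENNReal.summable).symm
      _ = ∑' v : Site 3, ENNReal.ofReal (boxRowSum J β N v ^ 4) := by
          refine tsum_congr fun v => ?_
          rw [hP, sum_piFinset_prod_eq J β hβ hJ N v]
      _ ≤ ∑' v : Site 3, ENNReal.ofReal (g v) := ENNReal.tsum_le_tsum fun v => ENNReal.ofReal_le_ofReal (hFg v)
      _ = ENNReal.ofReal (∑' v, g v) := (ENNReal.ofReal_tsum_of_nonneg hg0 hgs).symm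
  have hfin : ∀ u ∈ P, treeFourE J β u ≠ ⊤ := fun u hu =>
    ne_top_of_le_ne_top ENNReal.ofReal_ne_top ((Finset.single_le_sum (fun _ _ => bot_le) hu).trans htot)
  refine ⟨hfin, ?_⟩
  rw [← ENNReal.toReal_sum hfin]
  have h := ENNReal.toReal_mono ENNReal.ofReal_ne_top htot
  rwa [ENNReal.toReal_ofReal (tsum_nonneg hg0)] at h

end LongRangeIsing

open LongRangeIsing

/-- **The tree box sum for `d = 3` from MMS2, the infrared bound and `χ_L ≤ C₂L^{-3}Σ_L`** (the
computation of `panis_ursellFourBoxSum_le_dim3_mms`, p. 22 of the source without the sliding-scale bound,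
with the tree diagram bound step replaced by the identity `∑_{u∈Λ⁴}T(u) = ∑_v F(v)⁴`): for
`J_{x,y} = C₀|x-y|₁^{-3-α}` with `3 - 2(α∧2) > 0` there are `C, γ > 0` (`γ = 15`) such that for all
`0 < β ≤ β_c`, `L, R ≥ 1`, the tree diagrams on `Λ_{RL}` are finite and
`𝒮_T(β,L,R) ≤ C (β⁻⁴ ∨ β⁻²) R^γ / L^{3-2α}`. [cite: Panis2023Triviality, proof of Theorem 5.5, bounds on (1) and (2) (p. 22), with Corollary 3.3 (MMS2) and Remark 5.4] -/
theorem treeFourBoxSum_le_dim3_mms (hM : panis_mms_two_point_monotone)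
    (hI : panis_infraredBound_algebraic) (hX : panis_boxSusceptibility_le_blockVariance)
    {C₀ α : ℝ} (hC₀ : 0 < C₀) (hα : 0 < α) (hexp : 0 < ((3 : ℕ) : ℝ) - 2 * min α 2) :
    ∃ C γ : ℝ, 0 < C ∧ 0 < γ ∧
      ∀ (β : ℝ), 0 < β → β ≤ LongRangeIsing.criticalBeta (algebraicCoupling 3 C₀ α) →
        ∀ (L R : ℕ), 1 ≤ L → 1 ≤ R →
          (∀ u ∈ Fintype.piFinset (fun _ : Fin 4 => box 3 (R * L)), treeFourE (algebraicCoupling 3 C₀ α) β u ≠ ⊤) ∧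
          treeFourBoxSum (algebraicCoupling 3 C₀ α) β L R ≤
            C * max (β ^ (-(4 : ℝ))) (β ^ (-(2 : ℝ))) * (R : ℝ) ^ γ / (L : ℝ) ^ (((3 : ℕ) : ℝ) - 2 * min α 2) := by
  set J := algebraicCoupling 3 C₀ α with hJdef
  have hJ0 : ∀ x y, 0 ≤ J x y := algebraicCoupling_nonneg hC₀.le α
  have hJt : ∀ a x y, J (x + a) (y + a) = J x y := algebraicCoupling_add C₀ α
  have hmin : min α 2 = α := by
    apply min_eq_left
    by_contra h
    push Not at h
    rw [min_eq_right h.le] at hexp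
    norm_num at hexp
  have hα32 : α < 3 / 2 := by rw [hmin] at hexp; push_cast at hexp; linarith
  set η : ℝ := 2 - α with hη
  have hη0 : 0 ≤ η := by rw [hη]; linarith
  have hη2 : η < 2 := by rw [hη]; linarith
  have hηhalf : 1 / 2 < η := by rw [hη]; linarith
  have hη1 : 0 < 2 * η - 1 := by linarith
  have h2η : 0 < 2 - η := by linarith
  obtain ⟨CE, hCE, hE⟩ := hI 3 le_rfl C₀ α hC₀ hα (by linarith)
  obtain ⟨C₂, hC₂, hX'⟩ := hX 3 (by norm_num) C₀ α hC₀ hα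
  set βc : ℝ := LongRangeIsing.criticalBeta J with hβcdef
  set C₄ : ℝ := 1 + 26 * CE * (1 + 1 / (2 - η)) with hC₄
  set K₁ : ℝ := 2 * 729 * (730 * 125) ^ 4 * C₄ ^ 2 * C₂ ^ 2 with hK₁
  set K₂ : ℝ := 2 * 26 * 9 * 3 ^ 12 * CE ^ 2 * C₂ ^ 2 / (2 * η - 1) with hK₂
  have hK₁0 : 0 ≤ K₁ := by positivity
  have hK₂0 : 0 ≤ K₂ := by positivity
  refine ⟨(K₁ + K₂ + 1) * max (βc ^ 2) 1, 15, by positivity, by norm_num, ?_⟩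
  intro β hβ hβc L R hL hR
  have hL0 : (0 : ℝ) < L := by exact_mod_cast hL
  have hR0 : (0 : ℝ) < R := by exact_mod_cast hR
  -- the facts at this `β`
  have hmms : ∀ x y : Site 3, (3 : ℝ) * ‖x‖ ≤ ‖y‖ → pairCorrelation J β 0 y ≤ pairCorrelation J β 0 x :=
    fun x y h => hM 3 (by norm_num) C₀ α hC₀ hα β hβ x y (by exact_mod_cast h)
  have hEβ : ∀ x : Site 3, x ≠ 0 → pairCorrelation J β 0 x ≤ CE / ‖x‖ ^ (1 + η) := by
    intro x hx
    have h := hE β hβ hβc x hx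
    rwa [hmin, show ((3 : ℕ) : ℝ) - α = 1 + η by rw [hη]; push_cast; ring] at h
  have hXβ : boxSusceptibility J β L ≤ C₂ * ((L : ℝ) ^ 3)⁻¹ * LongRangeIsing.blockVariance J β L := hX' β hβ hβc L hL
  -- the quantities of p. 22
  set χ : ℝ := boxSusceptibility J β L with hχ
  set V : ℝ := LongRangeIsing.blockVariance J β L with hV
  have hχ0 : 0 ≤ χ := boxSusceptibility_nonneg J β hβ.le hJ0 L
  have hV1 : 1 ≤ V := one_le_blockVariance J β hβ.le hJ0 L
  have hV0 : 0 < V := by linarith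
  have hχ4 : χ ≤ C₄ * (L : ℝ) ^ (2 - η) := boxSusceptibility_le_of_irb J β hβ.le hJ0 hη2 hCE.le hEβ hL
  set A : ℝ := (730 * (125 * (R : ℝ) ^ 3) * χ) ^ 4 with hA
  set Bf : ℝ := 9 * CE ^ 2 * ((2 * (R * L) + 1 : ℕ) : ℝ) ^ 12 * χ ^ 2 / (L : ℝ) ^ 6 with hBf
  set q : ℝ := 2 + 2 * η with hq
  set M : ℕ := 4 * (R * L) with hMdef
  have hA0 : 0 ≤ A := by positivity
  have hB0 : 0 ≤ Bf := by positivity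
  have hq3 : 3 < q := by rw [hq]; linarith
  have hRL : 1 ≤ R * L := Nat.one_le_iff_ne_zero.2 (Nat.mul_ne_zero (by omega) (by omega))
  have hM1 : 1 ≤ M := by rw [hMdef]; omega
  -- the majorant of `F⁴`
  have hFg : ∀ u : Site 3, boxRowSum J β (R * L) u ^ 4 ≤ rowMajorant A Bf q M u := by
    intro u
    by_cases hu : u ∈ box 3 M
    · rw [rowMajorant, if_pos hu, hA]
      exact pow_le_pow_left₀ (boxRowSum_nonneg J β hβ.le hJ0 _ u) (boxRowSum_le_near_mms J β hβ.le hJ0 hJt hmms hR hL hu) 4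
    · rw [rowMajorant, if_neg hu, hBf, hq]
      have hu' : 4 * (R * L) + 1 ≤ Site.supNorm u := by
        rw [mem_box_iff_supNorm_le] at hu
        omega
      exact boxRowSum_pow_four_le_far_mms J β hβ.le hJ0 hJt hmms hη0 hη2 hEβ hR hL hu'
  obtain ⟨hsum, htsum⟩ := summable_rowMajorant hA0 hB0 hq3 hM1
  obtain ⟨hfin, hU⟩ := treeFourE_finite_and_sum_toReal_le hβ.le hJ0 (rowMajorant_nonneg hA0 hB0 q M) hsum hFg
  refine ⟨hfin, ?_⟩
  -- the two terms
  have hnear : 2 * (#(box 3 (4 * (R * L))) : ℝ) * (730 * (125 * (R : ℝ) ^ 3) * χ) ^ 4 / V ^ 2 ≤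
      K₁ * (R : ℝ) ^ (15 : ℝ) * (L : ℝ) ^ (1 - 2 * η) :=
    near_term_le_mms hχ0 hV1 hR hL hχ4 hXβ
  have hfar : 2 * (9 * CE ^ 2 * ((2 * (R * L) + 1 : ℕ) : ℝ) ^ 12 * χ ^ 2 / (L : ℝ) ^ 6) *
        (26 * (((4 * (R * L) : ℕ) : ℝ)) ^ (3 - (2 + 2 * η)) / (2 + 2 * η - 3)) / V ^ 2 ≤
      K₂ * (R : ℝ) ^ (15 : ℝ) * (L : ℝ) ^ (1 - 2 * η) :=
    far_term_le_mms hχ0 hV1 hηhalf hR hL hXβ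
  -- assemble
  have hS : treeFourBoxSum J β L R ≤ (K₁ + K₂) * ((R : ℝ) ^ (15 : ℝ) * (L : ℝ) ^ (1 - 2 * η)) := by
    have h1 : treeFourBoxSum J β L R ≤ 2 * ((#(box 3 M) : ℝ) * A + Bf * (26 * (M : ℝ) ^ (3 - q) / (q - 3))) / V ^ 2 := by
      rw [treeFourBoxSum]
      refine div_le_div_of_nonneg_right (hU.trans ?_) (sq_nonneg _)
      have h0 : 0 ≤ ∑' u, rowMajorant A Bf q M u := tsum_nonneg (rowMajorant_nonneg hA0 hB0 q M)
      linarith only [htsum, h0]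
    have h2 : 2 * ((#(box 3 M) : ℝ) * A + Bf * (26 * (M : ℝ) ^ (3 - q) / (q - 3))) / V ^ 2 =
        2 * (#(box 3 (4 * (R * L))) : ℝ) * (730 * (125 * (R : ℝ) ^ 3) * χ) ^ 4 / V ^ 2 +
        2 * (9 * CE ^ 2 * ((2 * (R * L) + 1 : ℕ) : ℝ) ^ 12 * χ ^ 2 / (L : ℝ) ^ 6) *
          (26 * (((4 * (R * L) : ℕ) : ℝ)) ^ (3 - (2 + 2 * η)) / (2 + 2 * η - 3)) / V ^ 2 := by
      rw [hA, hBf, hq, hMdef]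
      ring
    rw [h2] at h1
    linarith only [h1, hnear, hfar]
  -- `1 ≤ (β_c² ∨ 1) (β⁻⁴ ∨ β⁻²)` for `0 < β ≤ β_c`
  have hβc0 : 0 < βc := lt_of_lt_of_le hβ hβc
  have hm2 : β ^ (-(2 : ℝ)) ≤ max (β ^ (-(4 : ℝ))) (β ^ (-(2 : ℝ))) := le_max_right _ _
  have hm0 : 0 ≤ max (β ^ (-(4 : ℝ))) (β ^ (-(2 : ℝ))) := le_max_of_le_left (Real.rpow_nonneg hβ.le _)
  have hone : 1 ≤ max (βc ^ 2) 1 * max (β ^ (-(4 : ℝ))) (β ^ (-(2 : ℝ))) := by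
    have h1 : β ^ (-(2 : ℝ)) = (β ^ 2)⁻¹ := by
      rw [Real.rpow_neg hβ.le, show (2 : ℝ) = ((2 : ℕ) : ℝ) by norm_num, Real.rpow_natCast]
    have h2 : 1 ≤ βc ^ 2 * (β ^ 2)⁻¹ := by
      rw [← div_eq_mul_inv, le_div_iff₀ (by positivity), one_mul]
      exact pow_le_pow_left₀ hβ.le hβc 2
    calc (1 : ℝ) ≤ βc ^ 2 * (β ^ 2)⁻¹ := h2
      _ ≤ max (βc ^ 2) 1 * max (β ^ (-(4 : ℝ))) (β ^ (-(2 : ℝ))) := by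
          rw [← h1]
          exact mul_le_mul (le_max_left _ _) hm2 (by positivity) (by positivity)
  have hX0 : 0 ≤ (R : ℝ) ^ (15 : ℝ) * (L : ℝ) ^ (1 - 2 * η) := mul_nonneg (Real.rpow_nonneg hR0.le _) (Real.rpow_nonneg hL0.le _)
  have hcoef : K₁ + K₂ ≤ (K₁ + K₂ + 1) * max (βc ^ 2) 1 * max (β ^ (-(4 : ℝ))) (β ^ (-(2 : ℝ))) := by
    have h := mul_le_mul_of_nonneg_left hone (by positivity : 0 ≤ K₁ + K₂ + 1)
    rw [mul_one, ← mul_assoc] at h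
    linarith
  have hpow : (R : ℝ) ^ (15 : ℝ) * (L : ℝ) ^ (1 - 2 * η) = (R : ℝ) ^ (15 : ℝ) / (L : ℝ) ^ (((3 : ℕ) : ℝ) - 2 * min α 2) := by
    rw [hmin, show (1 : ℝ) - 2 * η = -(((3 : ℕ) : ℝ) - 2 * α) by rw [hη]; push_cast; ring, Real.rpow_neg hL0.le,
      div_eq_mul_inv]
  calc treeFourBoxSum J β L R ≤ (K₁ + K₂) * ((R : ℝ) ^ (15 : ℝ) * (L : ℝ) ^ (1 - 2 * η)) := hS
    _ ≤ (K₁ + K₂ + 1) * max (βc ^ 2) 1 * max (β ^ (-(4 : ℝ))) (β ^ (-(2 : ℝ))) *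
        ((R : ℝ) ^ (15 : ℝ) * (L : ℝ) ^ (1 - 2 * η)) := mul_le_mul_of_nonneg_right hcoef hX0
    _ = (K₁ + K₂ + 1) * max (βc ^ 2) 1 * max (β ^ (-(4 : ℝ))) (β ^ (-(2 : ℝ))) * (R : ℝ) ^ (15 : ℝ) /
        (L : ℝ) ^ (((3 : ℕ) : ℝ) - 2 * min α 2) := by
        rw [hpow, mul_div_assoc]


/-! ### Theorem 1.2 on `ℤ³` and the barrier from the infrared bound alone -/

/-- **The `d = 3` instance of Panis's Theorem 1.2 from MMS2, the infrared bound and `χ_L ≤ C₂L^{-3}Σ_L`** —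
the deviation from Wick's law being supplied by the PROVED tree-graph Wick bound (`mgfDeviation_le_tree`).
[cite: Panis2023Triviality, Theorem 1.2 (d = 3) and proof of Theorem 5.5 (pp. 21–22)] -/
theorem panis_thm12_dim3_of_tree (hM : panis_mms_two_point_monotone) (hI : panis_infraredBound_algebraic)
    (hX : panis_boxSusceptibility_le_blockVariance) : panis_thm12_dim3 := by
  intro C₀ α hC₀ hα hexp f hf hfs
  set J := algebraicCoupling 3 C₀ α with hJ
  have hJ0 : ∀ x y, 0 ≤ J x y := algebraicCoupling_nonneg hC₀.le α
  obtain ⟨C, γ, hC, _, hSb⟩ := treeFourBoxSum_le_dim3_mms hM hI hX hC₀ hα hexp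
  obtain ⟨R, hR, hfR⟩ := exists_nat_forall_abs_apply_le f hfs
  set F : ℝ := (⨆ x, |f x|) ^ 4 with hF
  have hF0 : 0 ≤ F := pow_nonneg (Real.iSup_nonneg fun x => abs_nonneg (f x)) 4
  refine ⟨32 * (F + 1) * C * (R : ℝ) ^ γ, by positivity, fun β hβ hβc L hL z => ?_⟩
  set V : ℝ := state J β 0 (fun σ => smeared J β L (fun x => |f x|) σ ^ 2) with hV
  set m : ℝ := max (β ^ (-(4 : ℝ))) (β ^ (-(2 : ℝ))) with hm
  set E : ℝ := (L : ℝ) ^ (((3 : ℕ) : ℝ) - 2 * min α 2) with hE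
  have hm0 : 0 ≤ m := le_max_of_le_left (Real.rpow_nonneg hβ.le _)
  have hE0 : 0 < E := Real.rpow_pos_of_pos (by exact_mod_cast hL) _
  obtain ⟨hfin, h2⟩ := hSb β hβ hβc L R hL hR
  have h1 := mgfDeviation_le_tree J β hJ0 hβ hL hR hf hfR hfin z
  have hS0 : 0 ≤ treeFourBoxSum J β L R := treeFourBoxSum_nonneg J β L R
  calc mgfDeviation J β L f z
      ≤ 32 * z ^ 4 * Real.exp (z ^ 2 / 2 * V) * F * treeFourBoxSum J β L R := h1
    _ ≤ 32 * z ^ 4 * Real.exp (z ^ 2 / 2 * V) * (F + 1) * (C * m * (R : ℝ) ^ γ / E) := by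
        apply mul_le_mul _ h2 hS0 (by positivity)
        exact mul_le_mul_of_nonneg_left (by linarith) (by positivity)
    _ = Real.exp (z ^ 2 / 2 * V) * (32 * (F + 1) * C * (R : ℝ) ^ γ * m * z ^ 4 / E) := by ring

/-- **The barrier `LongRangeTrivialityOnZ3` from the infrared bound ALONE** (`panis_infraredBound_algebraic`,
Panis 2023, Prop. 3.8 / §3.6): the deviation from Wick's law (Aizenman 1982, Prop. 12.1 — not dischargeable from
the held sources) is replaced by the PROVED tree-graph Wick bound of `TreeGraphWick*`; the tree diagram bound,
MMS2 (`panis_mms_two_point_monotone_holds`) and `χ_L ≤ C₂L^{-3}Σ_L`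
(`panis_boxSusceptibility_le_blockVariance_holds`) are theorems of the tree.
[cite: Panis2023Triviality, Theorem 1.2 and proof of Theorem 5.5 (pp. 21–22)] [cite: AizenmanCMP1982, Prop. 12.1 and Prop. 5.3] -/
theorem LongRangeTrivialityOnZ3.of_irb (hI : panis_infraredBound_algebraic) : LongRangeTrivialityOnZ3 :=
  LongRangeTrivialityOnZ3.of_thm12_dim3
    (panis_thm12_dim3_of_tree panis_mms_two_point_monotone_holds hI panis_boxSusceptibility_le_blockVariance_holds)

end Literature.Barriers.CriticalPhenomena

end
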